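import Mathlib
import Summits.ResolutionOfSingularities.ResolutionOfSingularities.Theorems.RadicialJungCleanModelsBestApproxOfDefectless
import Summits.ResolutionOfSingularities.ResolutionOfSingularities.Theorems.RadicialJungCleanModelsCleanLU3Defectless
import Literature.AlgebraicGeometry.Resolution.GeneralizedStabilityHolds
import HarnessLib

/-!
# Route `RadicialJung`, crux `CleanModels` (stmt-15917), stub `stub_cleanLU3Defect`: **clean local uniformization at every
# ABHYANKAR valuation** (transcendence defect `0`), modulo CJS Cor. 1.5 — via Kuhlmann's generalized stability theorem

Line `Sketch` rev 17 of crux stmt-ResolutionOfSingularities-15917; lead `res-B-lead-1` g2.  OURS; nothing here proves resolution in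
characteristic `p`.

* `exists_isMin_pthPowerApprox_of_isDefectlessField` — if `(K, K°)` is a defectless valued field and `g₀ ∉ K^p`, then `g₀` has a
  best `p`-th-power approximation: apply ✓ `exists_isMin_approx_of_isDefectlessIn` to `L = K[X]/(X^p - g₀)` (a field, `L^p ⊆ K`) and
  use `(θ - f)^p = g₀ - f^p`.
* `cleanLU3_of_isDefectlessField` — hence the conclusion of `stub_cleanLU3` at every valuation ring `O` of `K` for which `(K, O)` is a
  defectless field (✓ `cleanLU3_of_isMin_pthPowerApprox`, p677129), modulo `hEmb`.
* `cleanLU3_of_transcendenceDefect_eq_zero` — in particular at every valuation of `K/k` WITHOUT TRANSCENDENCE DEFECT (Abhyankar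
  valuations: `rat.rk + tr.deg of the residue field = tr.deg K/k`), by the generalized stability theorem (F.-V. Kuhlmann, Trans. AMS 362
  (2010), Thm. 1.1), PROVED in the tree as `Kuhlmann2010Stability_holds`.

So the research residue `stub_cleanLU3Defect` lives at zero-dimensional valuations of rational rank `≤ 2` (on a threefold).
-/

noncomputable section

set_option linter.dupNamespace false -- mandated namespace of this single-conjunct summit

open IsLocalRing Polynomial AlgebraicGeometry CategoryTheory
open Literature.AlgebraicGeometry.Resolution

namespace Summit.ResolutionOfSingularities.ResolutionOfSingularities.Theorems.RadicialJung.CleanModels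

variable {K : Type} [Field K] {p : ℕ} [hp : Fact p.Prime] [CharP K p]

/-! ## The radical extension `K[X]/(X^p - g₀)` -/

/-- In `L = K[X]/(X^p - g₀)` (`g₀ ∉ K^p`), every element has its `p`-th power in `K`. [folklore] -/
theorem exists_algebraMap_eq_pow_adjoinRoot (g₀ : K) (hg₀ : ∀ c : K, c ^ p ≠ g₀) :
    haveI : Fact (Irreducible (X ^ p - C g₀ : K[X])) := ⟨X_pow_sub_C_irreducible_of_prime hp.out hg₀⟩
    ∀ ξ : AdjoinRoot (X ^ p - C g₀ : K[X]), ∃ c : K,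
      algebraMap K (AdjoinRoot (X ^ p - C g₀ : K[X])) c = ξ ^ p := by
  haveI : Fact (Irreducible (X ^ p - C g₀ : K[X])) := ⟨X_pow_sub_C_irreducible_of_prime hp.out hg₀⟩
  set f : K[X] := X ^ p - C g₀ with hfdef
  haveI : CharP (AdjoinRoot f) p := charP_of_injective_algebraMap (algebraMap K (AdjoinRoot f)).injective p
  have hroot : (AdjoinRoot.root f) ^ p = algebraMap K (AdjoinRoot f) g₀ := by
    have h := AdjoinRoot.eval₂_root f
    rw [hfdef, eval₂_sub, eval₂_X_pow, eval₂_C, sub_eq_zero] at h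
    exact h
  intro ξ
  induction ξ using AdjoinRoot.induction_on with
  | ih q =>
    induction q using Polynomial.induction_on' with
    | add q₁ q₂ h₁ h₂ =>
      obtain ⟨c₁, hc₁⟩ := h₁
      obtain ⟨c₂, hc₂⟩ := h₂
      exact ⟨c₁ + c₂, by rw [map_add, hc₁, hc₂, map_add, add_pow_char]⟩
    | monomial n c =>
      refine ⟨c ^ p * g₀ ^ n, ?_⟩
      have h1 : AdjoinRoot.mk f (Polynomial.monomial n c) = algebraMap K (AdjoinRoot f) c * (AdjoinRoot.root f) ^ n := by
        rw [← Polynomial.C_mul_X_pow_eq_monomial, map_mul, map_pow, AdjoinRoot.mk_C, AdjoinRoot.mk_X, AdjoinRoot.algebraMap_eq]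
      rw [h1, mul_pow, ← pow_mul, mul_comm n p, pow_mul, hroot, ← map_pow, ← map_pow, ← map_mul]

/-! ## Best `p`-th-power approximation in a defectless field -/

omit hp in
/-- Comparison of values in `K` and in an extension `O'` of `O` to `L`: `v x ≤ v y ↔ v'(x) ≤ v'(y)`. [folklore] -/
theorem valuation_le_iff_of_comap_eq {L : Type} [Field L] [Algebra K L] (O : ValuationSubring K) (O' : ValuationSubring L)
    (h : O'.comap (algebraMap K L) = O) (x y : K) :
    O.valuation x ≤ O.valuation y ↔ O'.valuation (algebraMap K L x) ≤ O'.valuation (algebraMap K L y) := by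
  by_cases hy : y = 0
  · subst hy
    simp only [map_zero, le_zero_iff, map_eq_zero, map_eq_zero_iff _ (algebraMap K L).injective]
  · have hy' : algebraMap K L y ≠ 0 := fun h0 => hy ((map_eq_zero_iff _ (algebraMap K L).injective).mp h0)
    have h1 : O.valuation x ≤ O.valuation y ↔ x / y ∈ O := by
      rw [← O.valuation_le_one_iff, map_div₀, div_le_one₀ (zero_lt_iff.mpr ((Valuation.ne_zero_iff _).mpr hy))]
    have h2 : O'.valuation (algebraMap K L x) ≤ O'.valuation (algebraMap K L y) ↔ algebraMap K L (x / y) ∈ O' := by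
      rw [← O'.valuation_le_one_iff, map_div₀, map_div₀,
        div_le_one₀ (zero_lt_iff.mpr ((Valuation.ne_zero_iff _).mpr hy'))]
    rw [h1, h2, ← h]
    rfl

/-- **In a defectless valued field every `g₀ ∉ K^p` has a best `p`-th-power approximation.** [cite: Kuhlmann2010, Section 1 (p. 3)] -/
theorem exists_isMin_pthPowerApprox_of_isDefectlessField (O : ValuationSubring K) (hdef : IsDefectlessField K O)
    (g₀ : K) (hg₀ : ∀ c : K, c ^ p ≠ g₀) :
    ∃ f₀ : K, ∀ f : K, O.valuation (g₀ - f₀ ^ p) ≤ O.valuation (g₀ - f ^ p) := by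
  haveI : Fact (Irreducible (X ^ p - C g₀ : K[X])) := ⟨X_pow_sub_C_irreducible_of_prime hp.out hg₀⟩
  set f : K[X] := X ^ p - C g₀ with hfdef
  let L := AdjoinRoot f
  haveI : CharP L p := charP_of_injective_algebraMap (algebraMap K L).injective p
  have hf0 : f ≠ 0 := X_pow_sub_C_ne_zero hp.out.pos g₀
  haveI : FiniteDimensional K L := (AdjoinRoot.powerBasis hf0).finite
  have hpow : ∀ ξ : L, ∃ c : K, algebraMap K L c = ξ ^ p := exists_algebraMap_eq_pow_adjoinRoot g₀ hg₀
  have hroot : (AdjoinRoot.root f) ^ p = algebraMap K L g₀ := by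
    have h := AdjoinRoot.eval₂_root f
    rw [hfdef, eval₂_sub, eval₂_X_pow, eval₂_C, sub_eq_zero] at h
    exact h
  obtain ⟨O', hO'⟩ := exists_valuationSubring_comap_eq O hpow
  obtain ⟨f₀, hf₀⟩ := exists_isMin_approx_of_isDefectlessIn O hpow O' hO' (hdef L inferInstance) (AdjoinRoot.root f)
  refine ⟨f₀, fun c => ?_⟩
  rw [valuation_le_iff_of_comap_eq O O' hO']
  have hpth : ∀ c : K, algebraMap K L (g₀ - c ^ p) = (AdjoinRoot.root f - algebraMap K L c) ^ p := fun c => by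
    rw [sub_pow_char, hroot, map_sub, map_pow]
  rw [hpth, hpth, map_pow, map_pow]
  exact pow_le_pow_left₀ zero_le (hf₀ c) p

/-! ## Clean local uniformization at defectless / Abhyankar valuations -/

/-- **`CleanLU3` at every valuation ring `O` for which `(K, O)` is a defectless field**, modulo CJS Cor. 1.5 (`hEmb`): the conclusion
of `stub_cleanLU3`. [cite: CossartJannsenSaito2020, Cor. 1.5, p. 7] -/
theorem cleanLU3_of_isDefectlessField
    (hEmb : ∀ (Z : Scheme.{0}) [IsIntegral Z] [IsNoetherian Z], Scheme.IsRegular Z →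
      Scheme.IsExcellent Z → ∀ (X : Set Z), IsClosed X → X ≠ Set.univ → topologicalKrullDim X ≤ 2 →
        ∃ (Z' : Scheme.{0}) (π : Z' ⟶ Z), IsProper π ∧ Function.Surjective π.base ∧
          (∃ U : Z.Opens, (U : Set Z) = Xᶜ ∧ IsIso (π ∣_ U)) ∧
          IsStrictNormalCrossingsDivisor Z' (π.base ⁻¹' X))
    (p : ℕ) (hp : p.Prime) (k : Type) [Field k] [CharP k p] (K : Type) [Field K] [Algebra k K]
    (O : ValuationSubring K) (A : Subalgebra k K) (hAO : A.toSubring ≤ O.toSubring) (hAfg : A.FG)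
    (hfrac : IsFractionRing A K)
    (hreg : IsRegularLocalRing (locAtCentre A.toSubring O))
    (hdim3 : ringKrullDim (locAtCentre A.toSubring O) = 3)
    (g₀ : K) (hg₀ : ∀ c : K, c ^ p ≠ g₀) (hdef : IsDefectlessField K O) :
    ∃ (A' : Subalgebra k K), A'.toSubring ≤ O.toSubring ∧ A ≤ A' ∧ A'.FG ∧
      ∃ (_ : IsRegularLocalRing (locAtCentre A'.toSubring O)) (c : Fin p → K),
        (∃ j : Fin p, (j : ℕ) ≠ 0 ∧ c j ≠ 0) ∧
        ((∃ (d m : ℕ) (hmd : m ≤ d) (t : Fin d → ↥(locAtCentre A'.toSubring O)) (a : Fin m → ℕ)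
            (u : ↥(locAtCentre A'.toSubring O)), IsUnit u ∧
            Ideal.span (Set.range t) = IsLocalRing.maximalIdeal ↥(locAtCentre A'.toSubring O) ∧
            ringKrullDim ↥(locAtCentre A'.toSubring O) = (d : WithBot ℕ∞) ∧ 0 < m ∧ (∀ i, ¬ p ∣ a i) ∧
            (∑ j : Fin p, c j ^ p * g₀ ^ (j : ℕ)) =
              (u : K) * ∏ i : Fin m, ((t (Fin.castLE hmd i) : ↥(locAtCentre A'.toSubring O)) : K) ^ (a i)) ∨
          (∃ u : ↥(locAtCentre A'.toSubring O), IsUnit u ∧ (∑ j : Fin p, c j ^ p * g₀ ^ (j : ℕ)) = (u : K) ∧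
            ∀ c' : ↥(locAtCentre A'.toSubring O), u - c' ^ p ∉ IsLocalRing.maximalIdeal ↥(locAtCentre A'.toSubring O)) ∨
          (∃ s c' : ↥(locAtCentre A'.toSubring O), (∑ j : Fin p, c j ^ p * g₀ ^ (j : ℕ)) = (s : K) ∧
            s - c' ^ p ∈ IsLocalRing.maximalIdeal ↥(locAtCentre A'.toSubring O) ∧
            s - c' ^ p ∉ IsLocalRing.maximalIdeal ↥(locAtCentre A'.toSubring O) ^ 2)) := by
  haveI : Fact p.Prime := ⟨hp⟩
  haveI : CharP K p := charP_of_injective_algebraMap (algebraMap k K).injective p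
  obtain ⟨f₀, hf₀⟩ := exists_isMin_pthPowerApprox_of_isDefectlessField O hdef g₀ hg₀
  exact cleanLU3_of_isMin_pthPowerApprox hEmb p hp k K O A hAO hAfg hfrac hreg hdim3 g₀ hg₀ f₀ hf₀

/-- The function field of a finitely generated affine model is finitely generated as a field. [folklore] -/
theorem intermediateField_top_fg {k K : Type} [Field k] [Field K] [Algebra k K] (A : Subalgebra k K) (hAfg : A.FG)
    (hfrac : IsFractionRing A K) : (⊤ : IntermediateField k K).FG := by
  obtain ⟨s₀, hs₀⟩ := hAfg
  refine ⟨s₀, le_antisymm le_top fun x _ => ?_⟩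
  obtain ⟨a, b, -, hab⟩ := IsFractionRing.div_surjective (A := A) x
  have hA : ∀ y : A, (y : K) ∈ IntermediateField.adjoin k (s₀ : Set K) := fun y => by
    have hy : (y : K) ∈ Algebra.adjoin k (s₀ : Set K) := by rw [hs₀]; exact y.2
    exact IntermediateField.algebra_adjoin_le_adjoin k _ hy
  rw [← hab]
  exact div_mem (hA a) (hA b)

/-- **`CleanLU3` at every valuation WITHOUT TRANSCENDENCE DEFECT** (Abhyankar valuations of `K/k`), modulo CJS Cor. 1.5: by
Kuhlmann's generalized stability theorem (✓ `Kuhlmann2010Stability_holds`) `(K, O)` is a defectless field.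
[cite: Kuhlmann2010, Thm. 1.1] [cite: CossartJannsenSaito2020, Cor. 1.5, p. 7] -/
theorem cleanLU3_of_transcendenceDefect_eq_zero
    (hEmb : ∀ (Z : Scheme.{0}) [IsIntegral Z] [IsNoetherian Z], Scheme.IsRegular Z →
      Scheme.IsExcellent Z → ∀ (X : Set Z), IsClosed X → X ≠ Set.univ → topologicalKrullDim X ≤ 2 →
        ∃ (Z' : Scheme.{0}) (π : Z' ⟶ Z), IsProper π ∧ Function.Surjective π.base ∧
          (∃ U : Z.Opens, (U : Set Z) = Xᶜ ∧ IsIso (π ∣_ U)) ∧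
          IsStrictNormalCrossingsDivisor Z' (π.base ⁻¹' X))
    (p : ℕ) (hp : p.Prime) (k : Type) [Field k] [CharP k p] (K : Type) [Field K] [Algebra k K]
    (O : ValuationSubring K) (A : Subalgebra k K) (hAO : A.toSubring ≤ O.toSubring) (hAfg : A.FG)
    (hfrac : IsFractionRing A K)
    (hreg : IsRegularLocalRing (locAtCentre A.toSubring O))
    (hdim3 : ringKrullDim (locAtCentre A.toSubring O) = 3)
    (g₀ : K) (hg₀ : ∀ c : K, c ^ p ≠ g₀)
    (hk : ∀ c : k, algebraMap k K c ∈ O) (htd : transcendenceDefect k O hk = 0) :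
    ∃ (A' : Subalgebra k K), A'.toSubring ≤ O.toSubring ∧ A ≤ A' ∧ A'.FG ∧
      ∃ (_ : IsRegularLocalRing (locAtCentre A'.toSubring O)) (c : Fin p → K),
        (∃ j : Fin p, (j : ℕ) ≠ 0 ∧ c j ≠ 0) ∧
        ((∃ (d m : ℕ) (hmd : m ≤ d) (t : Fin d → ↥(locAtCentre A'.toSubring O)) (a : Fin m → ℕ)
            (u : ↥(locAtCentre A'.toSubring O)), IsUnit u ∧
            Ideal.span (Set.range t) = IsLocalRing.maximalIdeal ↥(locAtCentre A'.toSubring O) ∧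
            ringKrullDim ↥(locAtCentre A'.toSubring O) = (d : WithBot ℕ∞) ∧ 0 < m ∧ (∀ i, ¬ p ∣ a i) ∧
            (∑ j : Fin p, c j ^ p * g₀ ^ (j : ℕ)) =
              (u : K) * ∏ i : Fin m, ((t (Fin.castLE hmd i) : ↥(locAtCentre A'.toSubring O)) : K) ^ (a i)) ∨
          (∃ u : ↥(locAtCentre A'.toSubring O), IsUnit u ∧ (∑ j : Fin p, c j ^ p * g₀ ^ (j : ℕ)) = (u : K) ∧
            ∀ c' : ↥(locAtCentre A'.toSubring O), u - c' ^ p ∉ IsLocalRing.maximalIdeal ↥(locAtCentre A'.toSubring O)) ∨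
          (∃ s c' : ↥(locAtCentre A'.toSubring O), (∑ j : Fin p, c j ^ p * g₀ ^ (j : ℕ)) = (s : K) ∧
            s - c' ^ p ∈ IsLocalRing.maximalIdeal ↥(locAtCentre A'.toSubring O) ∧
            s - c' ^ p ∉ IsLocalRing.maximalIdeal ↥(locAtCentre A'.toSubring O) ^ 2)) :=
  cleanLU3_of_isDefectlessField hEmb p hp k K O A hAO hAfg hfrac hreg hdim3 g₀ hg₀
    (Kuhlmann2010Stability_holds k K (intermediateField_top_fg A hAfg hfrac) O hk htd)

end Summit.ResolutionOfSingularities.ResolutionOfSingularities.Theorems.RadicialJung.CleanModels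

end
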